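import Literature.MathematicalPhysics.QuantumFieldTheory.Balaban1983to89.B1Eq324BenfattoClassEntryFromCovariance
import Literature.MathematicalPhysics.QuantumFieldTheory.Balaban1983to89.B1Eq324BenfattoKernelSect5ClassBasicLemma
import Literature.MathematicalPhysics.QuantumFieldTheory.Balaban1983to89.B1Eq324BenfattoKernelEq324AnyGamma
import Literature.MathematicalPhysics.QuantumFieldTheory.Balaban1983to89.B1Eq324BenfattoKernelEq324AnyGammaUnitRange
import HarnessLib

/-!
# `Balaban1983to89.B1Eq324BenfattoClassEntryFromCovarianceUniform` — [BenfattoEtAl1978] Appendix C 1) (C.2)–(C.5) p. 164 for the class of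
# [Balaban1985BackgroundPropagators] Sect. E p. 428, entered from the covariance side WITH THE CLASS CONSTANTS CHOSEN BEFORE THE MEMBER: from the
# scalars `(d, g, Λ_G, K_G, κ)` alone one rate `θ` and one signed row package `(J_c, V, M, V₂, M₂, V₄)` serve EVERY symmetric `g`-coercive `Λ_G`-bounded
# `K_G e^{−κ|·|₂}`-decaying covariance `G` on EVERY finite `Λ ⊂ ℤ^d` — Lemma (4.6)–(4.7) and B1 (3.24) for all of them at once; PROVED, no definition

statement-level skeleton of published theorems with citation tags; proofs where landed; nothing here is a claim about the
Yang–Mills mass gap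

WHY THIS MODULE (cell `pub-ymgap`, width seat `dag-n08-w5` gen 3; node N08 [Balaban1985UV3]; the [BenfattoEtAl1978] source chain behind the
(α)-row `h324`).  Seat n08-c's `…KernelSect5ClassBasicLemma.classBasicLemma_signed` quantifies `∃ b* ∀ (t D ϰ) ∃ (S ρ₁ ρ₂ ρ₃ ρ₄) ∀ members`: the
class constants `(γ_A, J_c, θ, V, M, V₂, M₂, V₄)` — with their signs `0 ≤ J_c < γ_A`, `0 < θ`, `V, M, V₂, M₂, V₄ ≥ 0` — are fixed BEFORE the member
`(Λ, A, K)`, and the threshold `b*` depends on them only.  The covariance-side entry `…ClassEntryFromCovariance` (this seat, gen 2) proved the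
rows per covariance `G` (`classRows_of_covariance`, explicit constants; `exists_classRows_of_covariance`, `∃` AFTER `G`).  An instantiation whose
members come as a FAMILY of covariances with common bounds (one per step / history / background) needs the other binder order: this file
chooses the two rates from the scalars first (`exists_covRate`, `exists_precisionRate` read no member), records every sign the knit asks, and
then serves all members at once (§2); §1 is the `hK` door — the zero-extension of `G` is the zero-extension of `(G⁻¹)⁻¹`, i.e. the member
`(Λ, G⁻¹, K)` has the kernel shape every class theorem displays; §3 notes the variance normalisation `Λ_G ≤ ½ ⇒ γ_A = 1/Λ_G ≥ 2` (the general
case is a rescaling of the member, seat n08-b's `…ClassRescale`, not done here); §4 composes §1–§3 with the knit: the Lemma of p. 152 for EVERY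
member of such a covariance family, constants first; §5 composes §1 with seat n08-b's precision-side `…KernelEq324AnyGamma.eq324_kernel_of_expDecay`
(no pad, any `γ_A`): B1 (3.24) for every member of such a family, in the covariance's own currency.  v1.1 (gen 4, INTENT-2; §§1–5 byte-identical):
§6 is the UNIT-RANGE edition of §5 — the same composition over seat n08-b's `…KernelEq324AnyGammaUnitRange.eq324_kernel_of_expDecay_on_unit` (itself over
seat n08-d's `…KernelEq324UnitRange` and seat n08-w4's `…Eq324UnitRange`): (3.24) at EVERY coupling `η ∈ (0,1]` under a displayed threshold window `b₁ < b₀`,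
the binder order seat n08-w4's all-steps (α)-socket consumes (`…RowClassSocketEndCovUnitRange`).

WHAT IS PROVED (theorems only; no definition, no named fact, no `sorry`; axioms standard).
* §1 `isUnit_det_of_coercive`, ★ `kernel_of_covariance` (`K = G` zero-extended ⇒ `K = (G⁻¹)⁻¹` zero-extended: the `hK` binder for `A := G⁻¹`).
* §2 ★★★ `exists_classConsts_of_covarianceBounds` — `∀ d g Λ_G K_G κ` (`g, Λ_G, κ > 0`, `K_G ≥ 0`) `∃ θ J_c V M V₂ M₂ V₄` with `0 < θ`, `0 ≤ J_c < 1/Λ_G`,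
  `V, M, V₂, M₂, V₄ ≥ 0`, such that for EVERY finite `Λ` and EVERY symmetric `g`-coercive `Λ_G`-bounded `K_G e^{−κ|·|₂}`-decaying `G : Matrix Λ Λ ℝ`
  the precision `G⁻¹` is symmetric, `1/Λ_G`-coercive and has the six rows `hJc hV hM hV₂ hM₂ hV₄` of the class theorems at `(θ, J_c, V, M, V₂, M₂, V₄)`.
* §3 `two_le_inv_of_le_half` (`0 < Λ_G ≤ ½ ⇒ 2 ≤ 1/Λ_G`).
* §4 ★★★ `classBasicLemma_of_covarianceBounds` — `d ≥ 1`, `g > 0`, `0 < Λ_G ≤ ½`, `K_G ≥ 0`, `κ > 0` ⇒ `∃ b* ∀ t D ϰ>0 ∃ (S ≥ 0, ρ₁, ρ₂, ρ₃ > 0, ρ₄) ∀ Λ G K`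
  (`K` = zero-extension of `G`; `G` symmetric, `g`-coercive, `Λ_G`-bounded, `K_G e^{−κ|·|₂}`-decaying; `Λ ≠ ∅`) `∀ s, b > b*, J ⊆ I` (padded), `𝔄`:
  (4.6) ∧ (4.7) for `𝒩(0,K)` — seat n08-c's `classBasicLemma_signed` conclusion VERBATIM, its nine member binders discharged from the covariance bounds.
* §5 ★★★ `eq324_covariance_of_expDecay` — `d ≥ 1`, `g, Λ_G, κ_G > 0`, `K_G ≥ 0`, `t, D, ϰ > 0`, `b₀ > 0`, `p₀ > 2/3`, `σ > 0`, `c ≥ 0`, `0 < κ < σ(t+1)` ⇒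
  `∃ η₀ ∈ (0,1], C ≥ 0, ∀ η ≤ η₀ ∀ Λ G K` (as in §4, no `Λ_G ≤ ½`) `∀ s, J ⊆ I, J ⊆ Λ, 𝔄` (`sup|A| ≤ cη^σ`):
  `0 < ∫Πχ̂_{I,p(η)}e^{H_J}d𝒩(0,K) ∧ |log ∫ − Σ_{k≤t}𝓔^T(H_J;k)/k!| ≤ Cη^κ|I|` — seat n08-b's `eq324_kernel_of_expDecay` conclusion VERBATIM (no pad).
* §6 (v1.1) ★★★ `eq324_covariance_of_expDecay_on_unit` — the same scalars WITHOUT `b₀` ⇒ `∃ b₁, ∀ b₀ > b₁, ∃ C ≥ 0, ∀ η ∈ (0,1] ∀ Λ G K` (as in §5) `∀ s, J ⊆ I, J ⊆ Λ, 𝔄`: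
  the same (3.24) pair — seat n08-b's `eq324_kernel_of_expDecay_on_unit` conclusion VERBATIM (no pad, every coupling; the window `b₁ < b₀` displayed, not decided).

HONEST SCOPE / NOT HERE.  Quantifier bookkeeping over `…ClassEntryFromCovariance`, `…KernelSect5ClassBasicLemma` and `…KernelEq324AnyGamma(UnitRange)` (applied BY
NAME; no estimate re-proved); in §4 the window padding `hpad` and the normalisation `Λ_G ≤ ½` stay hypotheses (§5∕§6 have neither); whether
[Balaban1985UV3]'s fluctuation covariances satisfy such bounds, and with which scalars, is the N06 [Balaban1985BackgroundPropagators] in-edge and the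
uncommissioned IDENT — NOT claimed; nothing of [Balaban1985UV3] / [Balaban1985UV2] is asserted; N08 is NOT discharged by this file; count-neutral;
nothing about d = 4, the continuum, OS axioms, a mass gap or the Clay problem.
-/

noncomputable section

open MeasureTheory Finset Matrix
open scoped BigOperators

namespace Literature.MathematicalPhysics.QuantumFieldTheory.Balaban1983to89.B1Eq324BenfattoClassEntryFromCovarianceUniform

open Literature.MathematicalPhysics.QuantumFieldTheory
open Literature.MathematicalPhysics.QuantumFieldTheory.Balaban1983to89.B1Eq324BenfattoLemma
open Literature.MathematicalPhysics.QuantumFieldTheory.Balaban1983to89.B1Eq324BenfattoClassAppendixC (posDef_of_coercive)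
open Literature.MathematicalPhysics.QuantumFieldTheory.Balaban1983to89.B1Eq324BenfattoClassEntryFromCovariance
  (classRows_of_covariance exists_covRate exists_precisionRate inv_symm_of_coercive inv_coercive_of_form_le abs_inv_apply_le_mul_exp_of_covariance)
open Literature.MathematicalPhysics.QuantumFieldTheory.Balaban1983to89.B1Eq324BenfattoKernelSect5ClassBasicLemma (classBasicLemma_signed)
open Literature.MathematicalPhysics.QuantumFieldTheory.Balaban1983to89.B1Eq324BenfattoKernelEq324AnyGamma (eq324_kernel_of_expDecay)

variable {d : ℕ}

/-! ## §1  The `hK` door: the zero-extended covariance is the member's kernel -/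

section Door

variable {Λ : Finset (B1Eq324BenfattoLemma.Site d)} {G : Matrix Λ Λ ℝ} {g : ℝ}

/-- A symmetric coercive (`g > 0`) matrix is invertible. [cite: HornJohnson2013, Thm 7.2.1 (positive definite ⇒ nonsingular)] -/
theorem isUnit_det_of_coercive (hGs : ∀ e e', G e e' = G e' e) (hg0 : 0 < g)
    (hg : ∀ x : Λ → ℝ, g * ∑ e, x e ^ 2 ≤ ∑ e, ∑ e', G e e' * x e * x e') : IsUnit G.det :=
  (Matrix.isUnit_iff_isUnit_det _).1 (posDef_of_coercive hGs hg0 hg).isUnit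

/-- ★ **THE `hK` DOOR**: if the field's kernel `K` is the covariance `G` zero-extended off `Λ` and `G` is invertible, then `K` is the zero-extension of
`(G⁻¹)⁻¹` — literally the binder `hK : K x y = [x,y ∈ Λ]·(A⁻¹)_{xy}` of every class theorem for the member `(Λ, A := G⁻¹, K)`.
[cite: HornJohnson2013, §0.5 (`(A⁻¹)⁻¹ = A`); BenfattoEtAl1978, Appendix C (C.6) p.164 (class form; ours)] -/
theorem kernel_of_covariance {K : B1Eq324BenfattoLemma.Site d → B1Eq324BenfattoLemma.Site d → ℝ} (hG : IsUnit G.det)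
    (hKG : ∀ x y, K x y = if h : x ∈ Λ ∧ y ∈ Λ then G ⟨x, h.1⟩ ⟨y, h.2⟩ else 0) :
    ∀ x y, K x y = if h : x ∈ Λ ∧ y ∈ Λ then ((G⁻¹)⁻¹ : Matrix Λ Λ ℝ) ⟨x, h.1⟩ ⟨y, h.2⟩ else 0 := by
  intro x y
  rw [hKG x y, Matrix.nonsing_inv_nonsing_inv G hG]

end Door

/-! ## §2  The class constants chosen before the member -/

/-- The lattice constant `K_d(c) = (2/(1 − e^{−c/√d})·e^{c/√d})^d` is non-negative for `c ≥ 0`. [folklore] -/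
private theorem latticeConst_nonneg {c : ℝ} (hc : 0 ≤ c) :
    0 ≤ (2 / (1 - Real.exp (-(c / Real.sqrt d))) * Real.exp (c / Real.sqrt d)) ^ d := by
  apply pow_nonneg
  refine mul_nonneg (div_nonneg zero_le_two ?_) (Real.exp_pos _).le
  have h : Real.exp (-(c / Real.sqrt d)) ≤ 1 :=
    Real.exp_le_one_iff.mpr (neg_nonpos.mpr (div_nonneg hc (Real.sqrt_nonneg _)))
  linarith

/-- ★★★ **CLASS CONSTANTS BEFORE THE MEMBER.**  For every dimension `d` and scalars `g > 0`, `Λ_G > 0`, `K_G ≥ 0`, `κ > 0` there are a rate `θ > 0` and a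
row package `J_c, V, M, V₂, M₂, V₄` with `0 ≤ J_c < 1/Λ_G` and `V, M, V₂, M₂, V₄ ≥ 0` — all read from the scalars alone — such that for EVERY finite
`Λ ⊂ ℤ^d` and EVERY covariance `G : Matrix Λ Λ ℝ` that is symmetric, `g`-coercive (`g·Σx² ≤ ⟨x,Gx⟩`), form-bounded (`⟨x,Gx⟩ ≤ Λ_G·Σx²`) and entrywise
decaying (`|G e e′| ≤ K_G e^{−κ|e−e′|₂}`), the precision `A := G⁻¹` is symmetric, `(1/Λ_G)`-coercive and satisfies the six displayed rows
`hJc hV hM hV₂ hM₂ hV₄` of the class theorems (binder order of `…KernelSect5ClassBasicLemma.classBasicLemma_signed`, whose `γ_A := 1/Λ_G`): the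
rates come from `exists_covRate` / `exists_precisionRate` (scalars only), the rows from `classRows_of_covariance` per member.
[cite: BenfattoEtAl1978, Appendix C 1) (C.2)–(C.5) p.164, Lemma p.152 «constants … depending only on t, D, d, ϰ»; Balaban1985BackgroundPropagators, Sect. E p.428 (class form; ours)] -/
theorem exists_classConsts_of_covarianceBounds (d : ℕ) {g ΛG KG κ : ℝ} (hg0 : 0 < g) (hΛG0 : 0 < ΛG) (hKG : 0 ≤ KG) (hκ : 0 < κ) :
    ∃ θ Jc V M V₂ M₂ V₄ : ℝ, 0 < θ ∧ 0 ≤ Jc ∧ Jc < 1 / ΛG ∧ 0 ≤ V ∧ 0 ≤ M ∧ 0 ≤ V₂ ∧ 0 ≤ M₂ ∧ 0 ≤ V₄ ∧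
      ∀ {Λ : Finset (B1Eq324BenfattoLemma.Site d)} {G : Matrix Λ Λ ℝ},
        (∀ e e', G e e' = G e' e) →
        (∀ x : Λ → ℝ, g * ∑ e, x e ^ 2 ≤ ∑ e, ∑ e', G e e' * x e * x e') →
        (∀ x : Λ → ℝ, ∑ e, ∑ e', G e e' * x e * x e' ≤ ΛG * ∑ e, x e ^ 2) →
        (∀ e e' : Λ, |G e e'| ≤ KG * Real.exp (-(κ * Real.sqrt (∑ j, ((((e : B1Eq324BenfattoLemma.Site d) j : ℝ) - ((e' : B1Eq324BenfattoLemma.Site d) j : ℝ))) ^ 2)))) →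
          (∀ e e' : Λ, (G⁻¹ : Matrix Λ Λ ℝ) e e' = (G⁻¹ : Matrix Λ Λ ℝ) e' e) ∧
          (∀ x : Λ → ℝ, 1 / ΛG * ∑ e, x e ^ 2 ≤ ∑ e, ∑ e', (G⁻¹ : Matrix Λ Λ ℝ) e e' * x e * x e') ∧
          (∀ e : Λ, ∑ e' : Λ, |(G⁻¹ : Matrix Λ Λ ℝ) e e'| * (Real.cosh (θ * Real.sqrt (∑ j, ((((e : B1Eq324BenfattoLemma.Site d) j : ℝ) - ((e' : B1Eq324BenfattoLemma.Site d) j : ℝ))) ^ 2)) - 1) ≤ Jc) ∧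
          (∀ e : Λ, ∑ e' : Λ, Real.exp (-(θ * Real.sqrt (∑ j, ((((e : B1Eq324BenfattoLemma.Site d) j : ℝ) - ((e' : B1Eq324BenfattoLemma.Site d) j : ℝ))) ^ 2))) *
              (1 + Real.sqrt (∑ j, ((((e : B1Eq324BenfattoLemma.Site d) j : ℝ) - ((e' : B1Eq324BenfattoLemma.Site d) j : ℝ))) ^ 2)) ≤ V) ∧
          (∀ e : Λ, ∑ e' : Λ, |(G⁻¹ : Matrix Λ Λ ℝ) e e'| * (1 + Real.sqrt (∑ j, ((((e : B1Eq324BenfattoLemma.Site d) j : ℝ) - ((e' : B1Eq324BenfattoLemma.Site d) j : ℝ))) ^ 2)) ≤ M) ∧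
          (∀ e : Λ, ∑ e' : Λ, Real.exp (-(θ / 2 * Real.sqrt (∑ j, ((((e : B1Eq324BenfattoLemma.Site d) j : ℝ) - ((e' : B1Eq324BenfattoLemma.Site d) j : ℝ))) ^ 2))) ≤ V₂) ∧
          (∀ e : Λ, ∑ e' : Λ, |(G⁻¹ : Matrix Λ Λ ℝ) e e'| * Real.exp (θ / 2 * Real.sqrt (∑ j, ((((e : B1Eq324BenfattoLemma.Site d) j : ℝ) - ((e' : B1Eq324BenfattoLemma.Site d) j : ℝ))) ^ 2)) ≤ M₂) ∧
          (∀ e : Λ, ∑ e' : Λ, Real.exp (-(θ / 4 * Real.sqrt (∑ j, ((((e : B1Eq324BenfattoLemma.Site d) j : ℝ) - ((e' : B1Eq324BenfattoLemma.Site d) j : ℝ))) ^ 2))) *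
              (1 + Real.sqrt (∑ j, ((((e : B1Eq324BenfattoLemma.Site d) j : ℝ) - ((e' : B1Eq324BenfattoLemma.Site d) j : ℝ))) ^ 2)) ≤ V₄) := by
  -- the two rates, read from the scalars only
  obtain ⟨θ₁, hθ₁, hθ₁κ, hJ⟩ := exists_covRate (d := d) hg0 hKG hκ
  obtain ⟨θ, hθ, hθθ₁, hlt⟩ := exists_precisionRate (d := d) hΛG0 hθ₁ hJ
  -- the signs of the closed-form constants
  have hgap : 0 ≤ 1 / (g - KG * (32 * θ₁ ^ 2 / κ ^ 2) * (2 / (1 - Real.exp (-(κ / 2 / Real.sqrt d))) * Real.exp (κ / 2 / Real.sqrt d)) ^ d) :=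
    one_div_nonneg.mpr (sub_pos.mpr hJ).le
  have hK₁ : 0 ≤ (2 / (1 - Real.exp (-(θ₁ / 2 / Real.sqrt d))) * Real.exp (θ₁ / 2 / Real.sqrt d)) ^ d :=
    latticeConst_nonneg (by positivity)
  have hK₂ : 0 ≤ (2 / (1 - Real.exp (-(θ / 2 / Real.sqrt d))) * Real.exp (θ / 2 / Real.sqrt d)) ^ d :=
    latticeConst_nonneg (by positivity)
  have hK₈ : 0 ≤ (2 / (1 - Real.exp (-(θ / 8 / Real.sqrt d))) * Real.exp (θ / 8 / Real.sqrt d)) ^ d :=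
    latticeConst_nonneg (by positivity)
  refine ⟨θ, _, _, _, _, _, _, hθ, ?_, hlt, ?_, ?_, hK₂, ?_, ?_, fun hGs hg hΛG hGdec =>
    classRows_of_covariance hGs hg0 hg hΛG hKG hκ hGdec hθ₁ hθ₁κ hJ hθ hθθ₁⟩
  · exact mul_nonneg (mul_nonneg hgap (by positivity)) hK₁
  · exact mul_nonneg (by positivity) hK₂
  · exact mul_nonneg hgap (mul_nonneg (by positivity) hK₁)
  · exact mul_nonneg hgap hK₁
  · exact mul_nonneg (by positivity) hK₈

/-! ## §3  The variance normalisation -/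

/-- **`Λ_G ≤ ½` gives the normalised class**: `γ_A = 1/Λ_G ≥ 2` (the knit's `hγA2`; equivalently `K(x,x) ≤ Λ_G ≤ ½`, print's «E z_Δ² = ½»). A member with
`Λ_G > ½` is first rescaled (not here). [cite: BenfattoEtAl1978, §1 p.144 «E(z_Δ²) = ½»; Balaban1985BackgroundPropagators, Sect. E p.428 (class form; ours)] -/
theorem two_le_inv_of_le_half {ΛG : ℝ} (hΛG0 : 0 < ΛG) (hΛG : ΛG ≤ 1 / 2) : 2 ≤ 1 / ΛG := by
  rw [le_div_iff₀ hΛG0]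
  linarith


/-! ## §4  The Lemma of p. 152 for every member of an elliptic exponentially decaying covariance family -/

/-- ★★★ **THE CLASS BASIC LEMMA, COVARIANCE-SIDE, CONSTANTS BEFORE MEMBERS.**  For `d ≥ 1` and scalars `g > 0`, `0 < Λ_G ≤ ½`, `K_G ≥ 0`, `κ > 0` there is
ONE threshold `b*` such that for all `t, D` and `ϰ > 0` there is ONE signed package `(S ≥ 0, ρ₁, ρ₂, ρ₃ > 0, ρ₄)` with: for EVERY finite non-empty
`Λ ⊂ ℤ^d`, EVERY covariance `G : Matrix Λ Λ ℝ` (symmetric, `g`-coercive, `Λ_G`-bounded, `|G e e′| ≤ K_G e^{−κ|e−e′|₂}`) and the field `𝒩(0,K)` of its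
zero-extension `K`, every `s`, every `b > b*`, every `J ⊆ I` (`I ≠ ∅`, the sup-`b²`-thickening of `J` inside `Λ`) and every coefficient family `𝔄`:
(4.6) for every conditioning region `C ⊆ Λ` that is `b³ + √d(b²+1)` Euclidean-far from `J` and every `z̄`, AND (4.7) — the conclusion of seat n08-c's
`…KernelSect5ClassBasicLemma.classBasicLemma_signed` VERBATIM, for the member `(Λ, G⁻¹, K)` (§1 door, §2 constants, §3 normalisation).
[cite: BenfattoEtAl1978, Lemma p.152 (4.5)–(4.7), Remark 1, Appendix C 1) (C.2)–(C.5) p.164; Balaban1985BackgroundPropagators, (1.16)–(1.18) p.180, Sect. E p.428 (class form; ours)] -/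
theorem classBasicLemma_of_covarianceBounds (hd : 0 < d) {g ΛG KG κ : ℝ} (hg0 : 0 < g) (hΛG0 : 0 < ΛG) (hΛGhalf : ΛG ≤ 1 / 2)
    (hKG : 0 ≤ KG) (hκ : 0 < κ) :
    ∃ bstar : ℝ, ∀ (t D : ℕ) (ϰ : ℝ), 0 < ϰ →
      ∃ S ρ₁ ρ₂ ρ₃ ρ₄ : ℝ, 0 ≤ S ∧ 0 < ρ₃ ∧
        ∀ {Λ : Finset (B1Eq324BenfattoLemma.Site d)} {G : Matrix Λ Λ ℝ} {K : B1Eq324BenfattoLemma.Site d → B1Eq324BenfattoLemma.Site d → ℝ},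
          (∀ x y, K x y = if h : x ∈ Λ ∧ y ∈ Λ then G ⟨x, h.1⟩ ⟨y, h.2⟩ else 0) → Λ.Nonempty →
          (∀ e e', G e e' = G e' e) →
          (∀ x : Λ → ℝ, g * ∑ e, x e ^ 2 ≤ ∑ e, ∑ e', G e e' * x e * x e') →
          (∀ x : Λ → ℝ, ∑ e, ∑ e', G e e' * x e * x e' ≤ ΛG * ∑ e, x e ^ 2) →
          (∀ e e' : Λ, |G e e'| ≤ KG * Real.exp (-(κ * Real.sqrt (∑ j, ((((e : B1Eq324BenfattoLemma.Site d) j : ℝ) - ((e' : B1Eq324BenfattoLemma.Site d) j : ℝ))) ^ 2)))) →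
          ∀ (s : ℕ) (b : ℝ), bstar < b → ∀ (I J : Finset (B1Eq324BenfattoLemma.Site d)), I.Nonempty → J ⊆ I →
            (∀ x ∈ J, ∀ z : B1Eq324BenfattoLemma.Site d, (∀ i, ((|z i - x i| : ℤ) : ℝ) ≤ b ^ 2) → z ∈ Λ) → ∀ a : Coef d,
            (∀ (C : Finset (B1Eq324BenfattoLemma.Site d)) (zbar : B1Eq324BenfattoLemma.Site d → ℝ), C ⊆ Λ →
                (∀ c ∈ C, ∀ x ∈ J, b ^ 3 + Real.sqrt d * (b ^ 2 + 1) ≤ Real.sqrt (∑ j, (((x j : ℝ) - (c j : ℝ))) ^ 2)) →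
                ∫ z, cutoffBoltzmann (hamiltonian s D ϰ a J) I b z ∂((gaussianFieldOfKernel (condCov K C)).map
                    fun (ζ' : B1Eq324BenfattoLemma.Site d → ℝ) (x : B1Eq324BenfattoLemma.Site d) => condMean K C zbar x + ζ' x) ≤
                  Real.exp (cumulantSum (gaussianFieldOfKernel K) (hamiltonian s D ϰ a J) t +
                    (I.card : ℝ) * errTerm S ρ₁ ρ₂ ρ₃ ρ₄ (coefSup s D a J) b t)) ∧
            Real.exp (cumulantSum (gaussianFieldOfKernel K) (hamiltonian s D ϰ a J) t -
                  (I.card : ℝ) * errTerm S ρ₁ ρ₂ ρ₃ ρ₄ (coefSup s D a J) b t) ≤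
                ∫ z, cutoffBoltzmann (hamiltonian s D ϰ a J) I b z ∂gaussianFieldOfKernel K := by
  obtain ⟨θ, Jc, V, M, V₂, M₂, V₄, hθ, hJc0, hJcγ, hV0, hM0, hV₂0, hM₂0, hV₄0, hrows⟩ :=
    exists_classConsts_of_covarianceBounds d hg0 hΛG0 hKG hκ
  obtain ⟨bstar, h⟩ := classBasicLemma_signed hd (two_le_inv_of_le_half hΛG0 hΛGhalf) hJc0 hJcγ hθ hV0 hM0 hV₂0 hM₂0 hV₄0
  refine ⟨bstar, fun t D ϰ hϰ => ?_⟩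
  obtain ⟨S, ρ₁, ρ₂, ρ₃, ρ₄, hS, hρ₃, hall⟩ := h t D ϰ hϰ
  refine ⟨S, ρ₁, ρ₂, ρ₃, ρ₄, hS, hρ₃, ?_⟩
  intro Λ G K hKG hΛ hGs hg hΛG hGdec s b hb I J hI hJI hpad a
  obtain ⟨hAs, hγA, hJc, hV, hM, hV₂, hM₂, hV₄⟩ := hrows hGs hg hΛG hGdec
  exact hall (kernel_of_covariance (isUnit_det_of_coercive hGs hg0 hg) hKG) hΛ hAs hγA hJc hV hM hV₂ hM₂ hV₄ s b hb I J hI hJI hpad a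

/-! ## §5  B1 (3.24) for every member of an elliptic exponentially decaying covariance family («a covariance having an exponential decay property») -/

/-- ★★★ **(3.24) IN THE COVARIANCE'S OWN CURRENCY, CONSTANTS BEFORE MEMBERS.**  For `d ≥ 1`, scalars `g > 0`, `Λ_G > 0`, `K_G ≥ 0`, `κ_G > 0`, an order `t`,
degree `D`, tree rate `ϰ > 0` and threshold∕rate letters `b₀ > 0`, `p₀ > 2/3`, `σ > 0`, `c ≥ 0`, `0 < κ < σ(t+1)`: `∃ η₀ ∈ (0,1], C ≥ 0` such that for every
`η ∈ (0, η₀]`, EVERY finite non-empty `Λ ⊂ ℤ^d`, EVERY covariance `G : Matrix Λ Λ ℝ` — symmetric, `g`-coercive, `Λ_G`-bounded, `|G e e′| ≤ K_G e^{−κ_G|e−e′|₂}` —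
and the field `𝒩(0,K)` of its zero-extension, every `s`, `J ⊆ I` (`I ≠ ∅`), `J ⊆ Λ`, and coefficients with `sup|A| ≤ c·η^σ`:
`0 < ∫Π_Δχ̂_{I,p(η)} e^{H_J} d𝒩(0,K)` and `|log ∫Π_Δχ̂ e^{H_J} d𝒩(0,K) − Σ_{k≤t}𝓔^T(H_J;k)/k!| ≤ C·η^κ·|I|` — seat n08-b's precision-side
`…KernelEq324AnyGamma.eq324_kernel_of_expDecay` (no pad, any `γ_A`) at `γ_A := 1/Λ_G`, `K_A := 1/(g − J_G(θ₁))`, `κ_A := θ₁` with the covariance rate `θ₁` of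
`exists_covRate` (scalars only) and the Combes–Thomas decay of `G⁻¹` (`…ClassEntryFromCovariance.abs_inv_apply_le_mul_exp_of_covariance`), through the §1 door.
[cite: Balaban1982Higgs1, (3.24) p.616; Balaban1985UV3, p.261 «a covariance having an exponential decay property»; BenfattoEtAl1978, Lemma p.152, Appendix C (C.2) p.164; Balaban1985BackgroundPropagators, Sect. E p.428 (class form; ours)] -/
theorem eq324_covariance_of_expDecay (hd : 0 < d) {g ΛG KG κG : ℝ} (hg0 : 0 < g) (hΛG0 : 0 < ΛG) (hKG : 0 ≤ KG) (hκG : 0 < κG)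
    (t D : ℕ) {ϰ : ℝ} (hϰ : 0 < ϰ) {b₀ p₀ σ c κ : ℝ} (hb₀ : 0 < b₀) (hp₀ : 2 / 3 < p₀) (hσ : 0 < σ) (hc : 0 ≤ c) (hκ : 0 < κ)
    (hκσ : κ < σ * (t + 1)) :
    ∃ η₀ C : ℝ, 0 < η₀ ∧ η₀ ≤ 1 ∧ 0 ≤ C ∧ ∀ η : ℝ, 0 < η → η ≤ η₀ →
      ∀ {Λ : Finset (B1Eq324BenfattoLemma.Site d)} {G : Matrix Λ Λ ℝ} {K : B1Eq324BenfattoLemma.Site d → B1Eq324BenfattoLemma.Site d → ℝ},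
        (∀ x y, K x y = if h : x ∈ Λ ∧ y ∈ Λ then G ⟨x, h.1⟩ ⟨y, h.2⟩ else 0) → Λ.Nonempty →
        (∀ e e', G e e' = G e' e) →
        (∀ x : Λ → ℝ, g * ∑ e, x e ^ 2 ≤ ∑ e, ∑ e', G e e' * x e * x e') →
        (∀ x : Λ → ℝ, ∑ e, ∑ e', G e e' * x e * x e' ≤ ΛG * ∑ e, x e ^ 2) →
        (∀ e e' : Λ, |G e e'| ≤ KG * Real.exp (-(κG * Real.sqrt (∑ j, ((((e : B1Eq324BenfattoLemma.Site d) j : ℝ) - ((e' : B1Eq324BenfattoLemma.Site d) j : ℝ))) ^ 2)))) →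
        ∀ (s : ℕ) (I J : Finset (B1Eq324BenfattoLemma.Site d)) (a : Coef d), I.Nonempty → J ⊆ I → J ⊆ Λ →
          coefSup s D a J ≤ c * η ^ σ →
          0 < ∫ z, cutoffBoltzmann (hamiltonian s D ϰ a J) I (B10.pFun b₀ p₀ η) z ∂gaussianFieldOfKernel K ∧
            |Real.log (∫ z, cutoffBoltzmann (hamiltonian s D ϰ a J) I (B10.pFun b₀ p₀ η) z ∂gaussianFieldOfKernel K) -
                cumulantSum (gaussianFieldOfKernel K) (hamiltonian s D ϰ a J) t| ≤ C * η ^ κ * I.card := by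
  -- the covariance rate, read from the scalars only
  obtain ⟨θ₁, hθ₁, hθ₁κ, hJ⟩ := exists_covRate (d := d) hg0 hKG hκG
  have hKA : 0 ≤ 1 / (g - KG * (32 * θ₁ ^ 2 / κG ^ 2) * (2 / (1 - Real.exp (-(κG / 2 / Real.sqrt d))) * Real.exp (κG / 2 / Real.sqrt d)) ^ d) :=
    one_div_nonneg.mpr (sub_pos.mpr hJ).le
  obtain ⟨η₀, C, hη₀, hη₀1, hC, hE⟩ :=
    eq324_kernel_of_expDecay (d := d) hd (γA := 1 / ΛG) (one_div_pos.mpr hΛG0) hKA hθ₁ t D hϰ hb₀ hp₀ hσ hc hκ hκσ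
  refine ⟨η₀, C, hη₀, hη₀1, hC, fun η hη hηle Λ G K hKG' hΛ hGs hg hΛG hGdec s I J a hI hJI hJΛ hA => ?_⟩
  exact hE η hη hηle (kernel_of_covariance (isUnit_det_of_coercive hGs hg0 hg) hKG') hΛ (inv_symm_of_coercive hGs hg0 hg)
    (inv_coercive_of_form_le hGs hg0 hg hΛG) (abs_inv_apply_le_mul_exp_of_covariance hGs hg0 hg hKG hκG hθ₁.le hθ₁κ hGdec hJ)
    s I J a hI hJI hJΛ hA

/-! ## §6  B1 (3.24) for every member of an elliptic exponentially decaying covariance family AT EVERY COUPLING `η ∈ (0,1]` (unit range; threshold window displayed) -/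

/-- ★★★ **(3.24) IN THE COVARIANCE'S OWN CURRENCY, CONSTANTS BEFORE MEMBERS, AT EVERY COUPLING `η ∈ (0,1]`.**  For `d ≥ 1`, scalars `g > 0`, `Λ_G > 0`, `K_G ≥ 0`,
`κ_G > 0`, an order `t`, degree `D`, tree rate `ϰ > 0` and rate letters `p₀ > 2/3`, `σ > 0`, `c ≥ 0`, `0 < κ < σ(t+1)`: there is a threshold window `b₁` (scalars only)
such that for every `b₀ > b₁` there is `C ≥ 0` with: for EVERY `η ∈ (0, 1]`, EVERY finite non-empty `Λ ⊂ ℤ^d`, EVERY covariance `G : Matrix Λ Λ ℝ` — symmetric,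
`g`-coercive, `Λ_G`-bounded, `|G e e′| ≤ K_G e^{−κ_G|e−e′|₂}` — and the field `𝒩(0,K)` of its zero-extension, every `s`, `J ⊆ I` (`I ≠ ∅`), `J ⊆ Λ`, and coefficients
with `sup|A| ≤ c·η^σ`: `0 < ∫Π_Δχ̂_{I,p(η)} e^{H_J} d𝒩(0,K)` and `|log ∫Π_Δχ̂ e^{H_J} d𝒩(0,K) − Σ_{k≤t}𝓔^T(H_J;k)/k!| ≤ C·η^κ·|I|` — §5 with seat n08-b's unit-range
binder order (`…KernelEq324AnyGammaUnitRange.eq324_kernel_of_expDecay_on_unit`, over seat n08-d's `…KernelEq324UnitRange` and seat n08-w4's `…Eq324UnitRange`)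
at `γ_A := 1/Λ_G`, `K_A := 1/(g − J_G(θ₁))`, `κ_A := θ₁` (covariance rate `θ₁` of `exists_covRate`, Combes–Thomas decay of `G⁻¹`), through the §1 door.  The window
`b₁ < b₀` is a displayed record-vs-class proviso, not decided here.
[cite: Balaban1982Higgs1, (3.24) p.616; Balaban1985UV3, (7) p.257, p.261 «a covariance having an exponential decay property»; BenfattoEtAl1978, Lemma p.152, Appendix C (C.2) p.164; Balaban1985BackgroundPropagators, (1.16)–(1.18) p.180, Sect. E p.428 (class form; ours)] -/
theorem eq324_covariance_of_expDecay_on_unit (hd : 0 < d) {g ΛG KG κG : ℝ} (hg0 : 0 < g) (hΛG0 : 0 < ΛG) (hKG : 0 ≤ KG) (hκG : 0 < κG)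
    (t D : ℕ) {ϰ : ℝ} (hϰ : 0 < ϰ) {p₀ σ c κ : ℝ} (hp₀ : 2 / 3 < p₀) (hσ : 0 < σ) (hc : 0 ≤ c) (hκ : 0 < κ)
    (hκσ : κ < σ * (t + 1)) :
    ∃ b₁ : ℝ, ∀ b₀ : ℝ, b₁ < b₀ → ∃ C : ℝ, 0 ≤ C ∧ ∀ η : ℝ, 0 < η → η ≤ 1 →
      ∀ {Λ : Finset (B1Eq324BenfattoLemma.Site d)} {G : Matrix Λ Λ ℝ} {K : B1Eq324BenfattoLemma.Site d → B1Eq324BenfattoLemma.Site d → ℝ},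
        (∀ x y, K x y = if h : x ∈ Λ ∧ y ∈ Λ then G ⟨x, h.1⟩ ⟨y, h.2⟩ else 0) → Λ.Nonempty →
        (∀ e e', G e e' = G e' e) →
        (∀ x : Λ → ℝ, g * ∑ e, x e ^ 2 ≤ ∑ e, ∑ e', G e e' * x e * x e') →
        (∀ x : Λ → ℝ, ∑ e, ∑ e', G e e' * x e * x e' ≤ ΛG * ∑ e, x e ^ 2) →
        (∀ e e' : Λ, |G e e'| ≤ KG * Real.exp (-(κG * Real.sqrt (∑ j, ((((e : B1Eq324BenfattoLemma.Site d) j : ℝ) - ((e' : B1Eq324BenfattoLemma.Site d) j : ℝ))) ^ 2)))) →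
        ∀ (s : ℕ) (I J : Finset (B1Eq324BenfattoLemma.Site d)) (a : Coef d), I.Nonempty → J ⊆ I → J ⊆ Λ →
          coefSup s D a J ≤ c * η ^ σ →
          0 < ∫ z, cutoffBoltzmann (hamiltonian s D ϰ a J) I (B10.pFun b₀ p₀ η) z ∂gaussianFieldOfKernel K ∧
            |Real.log (∫ z, cutoffBoltzmann (hamiltonian s D ϰ a J) I (B10.pFun b₀ p₀ η) z ∂gaussianFieldOfKernel K) -
                cumulantSum (gaussianFieldOfKernel K) (hamiltonian s D ϰ a J) t| ≤ C * η ^ κ * I.card := by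
  -- the covariance rate, read from the scalars only
  obtain ⟨θ₁, hθ₁, hθ₁κ, hJ⟩ := exists_covRate (d := d) hg0 hKG hκG
  have hKA : 0 ≤ 1 / (g - KG * (32 * θ₁ ^ 2 / κG ^ 2) * (2 / (1 - Real.exp (-(κG / 2 / Real.sqrt d))) * Real.exp (κG / 2 / Real.sqrt d)) ^ d) :=
    one_div_nonneg.mpr (sub_pos.mpr hJ).le
  obtain ⟨b₁, hb₁⟩ :=
    B1Eq324BenfattoKernelEq324AnyGammaUnitRange.eq324_kernel_of_expDecay_on_unit (d := d) hd (γA := 1 / ΛG) (one_div_pos.mpr hΛG0) hKA hθ₁ t D hϰ hp₀ hσ hc hκ hκσ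
  refine ⟨b₁, fun b₀ hb₀ => ?_⟩
  obtain ⟨C, hC, hE⟩ := hb₁ b₀ hb₀
  refine ⟨C, hC, fun η hη hηle Λ G K hKG' hΛ hGs hg hΛG hGdec s I J a hI hJI hJΛ hA => ?_⟩
  exact hE η hη hηle (kernel_of_covariance (isUnit_det_of_coercive hGs hg0 hg) hKG') hΛ (inv_symm_of_coercive hGs hg0 hg)
    (inv_coercive_of_form_le hGs hg0 hg hΛG) (abs_inv_apply_le_mul_exp_of_covariance hGs hg0 hg hKG hκG hθ₁.le hθ₁κ hGdec hJ)
    s I J a hI hJI hJΛ hA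

end Literature.MathematicalPhysics.QuantumFieldTheory.Balaban1983to89.B1Eq324BenfattoClassEntryFromCovarianceUniform
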